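import Summits.AtomisticToContinuum.BoseEinsteinCondensation.Theorems.BECCutLineWeakDisorderTwoReplicaTransienceBoundFreeGas
import Summits.AtomisticToContinuum.BoseEinsteinCondensation.Theorems.BECCutLineWeakDisorderTwoReplicaTransienceBoundSurvivalFloor
import Literature.MathematicalPhysics.QuantumManyBody.GroundStateFeynmanKacCutLine
import Literature.MathematicalPhysics.QuantumManyBody.GroundStateFeynmanKacDisplacement
import Literature.MathematicalPhysics.QuantumManyBody.OneParticleMarginals
import Literature.MathematicalPhysics.QuantumManyBody.BoseGasThermodynamicLimitRuelle
import Literature.MathematicalPhysics.QuantumManyBody.BoseGasDirichletWall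
import Mathlib.Probability.Distributions.Gaussian.Real
import HarnessLib

/-!
# Crux `TwoReplicaTransienceBound` (stmt-AtomisticToContinuum-9687), line `tagged-shift-log-harnack`:
# two-time Markov property and the cross-cut Cauchy–Schwarz bound (tools, general `v`, `N`)

Support file (lead a1, from stub-worker W5's analysis of `stub_taggedDisplacement`). General tools
for two-time tagged observables under the `2T`-long flat-datum Feynman–Kac bridge:
`lintegral_fkWeight_mul₂_nnreal` (Markov property at an intermediate time with an observable read
inside the future segment), `crossCut_le_nnreal` / `crossCut_le` = registered toolbox stub
`stub_crossCutBound`: `∫dX E_X[w_{2T} e(B_{T+τ} - B_T)] ≤ E[e(√2 b_τ)] · Z(T-τ)^{1/2} · Z(T)^{1/2}`.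
For the interacting gas this bound is LOSSY by `(Z(T-τ)/Z(T))^{1/2} ≈ e^{τ E₀(N)}` (LeadA1Report F3);
for the free gas it is the engine of the free row of the stub (file `…TaggedShiftDisplacementFree`).
References: Chung–Zhao (1995) §3.2; Simon (1982) §A1. [folklore]
-/


noncomputable section

open MeasureTheory ProbabilityTheory Filter Set Finset
open scoped ENNReal NNReal Topology BigOperators

namespace Summit.AtomisticToContinuum.BoseEinsteinCondensation.Cruxes.TwoReplicaTransienceBound.TaggedShiftLogHarnack

open Literature.MathematicalPhysics.QuantumManyBody.BoseGas
open Literature.Probability.Process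
open Summit.AtomisticToContinuum.BoseEinsteinCondensation.Theses.BECCutLineWeakDisorder

/-! ### Markov property with an intermediate observation in the future segment -/

namespace TaggedDisplacement

variable {N : ℕ}

/-- **Markov property at time `s` for a two-time observable** (`ℝ≥0` times; general `v`, `N`):
for measurable `v` and `K ≥ 0`,
`E_X[w_{s+t}(ω) K(B_s, B_{s+u})] = (e^{-sH_N} Ĥ)(X)` with `Ĥ(y) = E_y[w_t(y, ω') K(y, B_u(y, ω'))]`
(the weight splits at `s`, the shifted paths are independent of the past with the Wiener law;
same proof as `lintegral_fkWeight_mul_mul_nnreal`, the observable being read at the intermediate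
time `u` of the shifted segment instead of its end). -/
theorem lintegral_fkWeight_mul₂_nnreal {v : ℝ → ℝ≥0∞} (hv : Measurable v) (L : ℝ) (s t u : ℝ≥0)
    {K : Config N × Config N → ℝ≥0∞} (hK : Measurable K) (X : Config N) :
    ∫⁻ ω, fkWeight v L ((s : ℝ) + t) X ω * K (worldLine X ω s, worldLine X ω (s + u))
        ∂wienerPaths N =
      fkSemigroup v L s (fun y => ∫⁻ ω', fkWeight v L t y ω' * K (y, worldLine y ω' u)
        ∂wienerPaths N) X := by
  -- measurability of the raw functional `((a, Y), w) ↦ a · rawWeight t Y w · K(Y, rawWorldLine Y w u)`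
  have hGm : Measurable fun q : (ℝ≥0∞ × Config N) × PathSpace N =>
      q.1.1 * ({p : Config N × PathSpace N | ∀ r ∈ Set.Icc (0 : ℝ) t, (fun i : Fin N =>
        p.1 i + WithLp.toLp 2 (fun k : Fin 3 =>
          Real.sqrt 2 * pathRegularize (p.2 i k) r.toNNReal)) ∈ boxN N L}.indicator
      (fun p => expNeg (∫⁻ r in Set.Ioc (0 : ℝ) t,
        interaction v (fun i : Fin N => p.1 i + WithLp.toLp 2 (fun k : Fin 3 =>
          Real.sqrt 2 * pathRegularize (p.2 i k) r.toNNReal)))) (q.1.2, q.2) *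
        K (q.1.2, fun i : Fin N => q.1.2 i + WithLp.toLp 2 (fun k : Fin 3 =>
          Real.sqrt 2 * pathRegularize (q.2 i k) u))) := by
    have hπ : Measurable fun q : (ℝ≥0∞ × Config N) × PathSpace N => (q.1.2, q.2) :=
      (measurable_snd.comp measurable_fst).prodMk measurable_snd
    refine (measurable_fst.comp measurable_fst).mul ?_
    exact ((measurable_rawWeight N hv L t).comp hπ).mul
      (hK.comp ((measurable_snd.comp measurable_fst).prodMk
        ((measurable_rawWorldLine_at' N u).comp hπ)))
  -- the pair `(w_s, B_s)` is a functional of the past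
  have hξ := measurable_comap_past_fkWeight_worldLine (N := N) hv L s X
  have key := lintegral_comp_pathsShift_eq N s hξ hGm
  simp only [rawWeight_pathsShift, rawWeight_pathsPath, raw_worldLine_pathsShift,
    raw_worldLine_pathsPath] at key
  refine Eq.trans ?_ (key.trans ?_)
  · refine lintegral_congr fun ω => ?_
    rw [fkWeight_add_eq_mul v L s t X ω]
    ring
  · simp only [fkSemigroup, Real.toNNReal_coe]
    refine lintegral_congr fun ω => ?_
    have hm : Measurable fun ω' : PathSpace N => fkWeight v L t (worldLine X ω s) ω' *
        K (worldLine X ω s, worldLine (worldLine X ω s) ω' u) :=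
      (measurable_fkWeight hv L t _).mul
        (hK.comp (measurable_const.prodMk (measurable_worldLine _ _)))
    calc ∫⁻ ω', fkWeight v L s X ω *
          (fkWeight v L t (worldLine X ω s) ω' * K (worldLine X ω s, worldLine (worldLine X ω s) ω' u))
          ∂wienerPaths N
        = fkWeight v L s X ω * ∫⁻ ω',
            fkWeight v L t (worldLine X ω s) ω' * K (worldLine X ω s, worldLine (worldLine X ω s) ω' u)
            ∂wienerPaths N := lintegral_const_mul _ hm
      _ = _ := rfl

/-! ### The cross-cut Cauchy–Schwarz bound (general `v`, `N`) -/

/-- Cauchy–Schwarz with a translate: `∫ φ'(y + d) φ(y) dy ≤ ‖φ'‖₂ ‖φ‖₂` (translation invariance of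
Lebesgue measure on `(ℝ³)^N`), the norms written as `fkNormSq`-style squares. -/
theorem lintegral_translate_mul_le {φ φ' : Config N → ℝ≥0∞} (hφ : Measurable φ) (hφ' : Measurable φ')
    (d : Config N) :
    ∫⁻ y, φ' (y + d) * φ y ≤ (∫⁻ y, φ' y ^ 2) ^ (1 / 2 : ℝ) * (∫⁻ y, φ y ^ 2) ^ (1 / 2 : ℝ) := by
  have h := ENNReal.lintegral_mul_le_Lp_mul_Lq (volume : Measure (Config N))
    Real.HolderConjugate.two_two (f := fun y => φ' (y + d)) (g := φ)
    (hφ'.comp (measurable_id.add_const d)).aemeasurable hφ.aemeasurable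
  have htr : ∫⁻ y, φ' (y + d) ^ (2 : ℝ) = ∫⁻ y, φ' y ^ (2 : ℝ) :=
    lintegral_add_right_eq_self (μ := (volume : Measure (Config N))) (fun y => φ' y ^ (2 : ℝ)) d
  simp only [Pi.mul_apply] at h
  rw [htr] at h
  simpa only [ENNReal.rpow_two] using h

/-- **The cross-cut Cauchy–Schwarz bound** (`ℝ≥0` times `u ≤ s`; general measurable `v`, every `N`,
`L`, and every measurable `e ≥ 0` of the displacement): the `2s`-long flat-datum bridge expectation
of `e(B_{s+u} - B_s)` is at most `E[e(√2 b_u)] · Z(s)^{1/2} · Z(s-u)^{1/2}`, `Z(t) = ‖e^{-tH_N}1‖₂²`.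
Chain: Markov at `s` with the two-time observable (`lintegral_fkWeight_mul₂_nnreal`), symmetry of
`e^{-sH_N}` (`lintegral_mul_fkSemigroup_comm`), Markov at `u` inside (`lintegral_fkWeight_mul_mul_nnreal`)
and DROPPING the weight on `[0, u]` (`fkWeight_le_one`: the displacement becomes the free Gaussian
`√2 b_u`, independent of the starting point), Tonelli, and Cauchy–Schwarz with a translate
(`lintegral_translate_mul_le`). For the interacting `N`-body system the right-hand side is useless
(`Z(s-u)/Z(s) ≈ e^{2uE₀(N)}`), for ONE free line it is the whole story. -/
theorem crossCut_le_nnreal {v : ℝ → ℝ≥0∞} (hv : Measurable v) (L : ℝ) {s u : ℝ≥0} (hus : u ≤ s)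
    {e : Config N → ℝ≥0∞} (he : Measurable e) :
    ∫⁻ X, ∫⁻ ω, fkWeight v L ((s : ℝ) + s) X ω * e (worldLine X ω (s + u) - worldLine X ω s)
        ∂wienerPaths N ≤
      (∫⁻ ω, e (displacement u ω) ∂wienerPaths N) *
        (fkNormSq (N := N) v L ((s - u : ℝ≥0) : ℝ) (fun _ => (1 : ℝ≥0∞)) ^ (1 / 2 : ℝ) *
          fkNormSq (N := N) v L s (fun _ => (1 : ℝ≥0∞)) ^ (1 / 2 : ℝ)) := by
  -- the two-time observable and the inner functional `Ĥ`
  set K : Config N × Config N → ℝ≥0∞ := fun p => e (p.2 - p.1) with hKdef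
  have hK : Measurable K := he.comp (measurable_snd.sub measurable_fst)
  set Hh : Config N → ℝ≥0∞ := fun y => ∫⁻ ω', fkWeight v L s y ω' * K (y, worldLine y ω' u)
    ∂wienerPaths N with hHdef
  have hHm : Measurable Hh := by
    have h : Measurable fun p : Config N × PathSpace N =>
        fkWeight v L s p.1 p.2 * K (p.1, worldLine p.1 p.2 u) :=
      (measurable_fkWeight_uncurry hv L s).mul
        (hK.comp (measurable_fst.prodMk (measurable_worldLine_uncurry' u)))
    exact h.lintegral_prod_right'
  set φ : Config N → ℝ≥0∞ := fkSemigroup v L s (fun _ => (1 : ℝ≥0∞)) with hφdef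
  set φ' : Config N → ℝ≥0∞ := fkSemigroup v L ((s - u : ℝ≥0) : ℝ) (fun _ => (1 : ℝ≥0∞)) with hφ'def
  have hφm : Measurable φ := measurable_fkSemigroup hv L _ measurable_const
  have hφ'm : Measurable φ' := measurable_fkSemigroup hv L _ measurable_const
  have h1m : Measurable (fun _ : Config N => (1 : ℝ≥0∞)) := measurable_const
  -- Step 1: Markov at `s`
  have h1 : ∀ X, ∫⁻ ω, fkWeight v L ((s : ℝ) + s) X ω * e (worldLine X ω (s + u) - worldLine X ω s)
      ∂wienerPaths N = fkSemigroup v L s Hh X := fun X =>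
    lintegral_fkWeight_mul₂_nnreal hv L s s u hK X
  -- Step 2: symmetry `∫ e^{-sH}Ĥ = ∫ Ĥ e^{-sH}1`
  have h2 : ∫⁻ X, fkSemigroup v L s Hh X = ∫⁻ X, Hh X * φ X := by
    have h := lintegral_mul_fkSemigroup_comm hv L s.coe_nonneg h1m hHm
    simpa only [one_mul] using h
  -- Step 3: Markov at `u` inside `Ĥ`, drop the weight on `[0, u]`
  have h3 : ∀ y, Hh y ≤ ∫⁻ ω', e (displacement u ω') * φ' (y + displacement u ω') ∂wienerPaths N := by
    intro y
    have hsu : s = u + (s - u) := (add_tsub_cancel_of_le hus).symm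
    have hKy : Measurable fun z => K (y, z) := hK.comp (measurable_const.prodMk measurable_id)
    have hM := lintegral_fkWeight_mul_mul_nnreal hv L u (s - u) hKy h1m y
    calc Hh y = ∫⁻ ω', fkWeight v L ((u : ℝ) + (s - u : ℝ≥0)) y ω' *
          (K (y, worldLine y ω' u) * (fun _ => (1 : ℝ≥0∞)) (worldLine y ω' (u + (s - u))))
          ∂wienerPaths N := by
          simp only [hHdef, mul_one, ← NNReal.coe_add, ← hsu]
      _ = fkSemigroup v L u (fun z => K (y, z) * φ' z) y := hM
      _ = ∫⁻ ω', fkWeight v L u y ω' * (K (y, worldLine y ω' u) * φ' (worldLine y ω' u))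
          ∂wienerPaths N := by simp only [fkSemigroup, Real.toNNReal_coe]
      _ ≤ ∫⁻ ω', K (y, worldLine y ω' u) * φ' (worldLine y ω' u) ∂wienerPaths N :=
          lintegral_mono fun ω' => mul_le_of_le_one_left' (fkWeight_le_one v L u y ω')
      _ = ∫⁻ ω', e (displacement u ω') * φ' (y + displacement u ω') ∂wienerPaths N := by
          refine lintegral_congr fun ω' => ?_
          simp only [hKdef, worldLine_eq_add_displacement, add_sub_cancel_left]
  -- Step 4: Tonelli and Cauchy–Schwarz with a translate
  have hed : Measurable fun ω' : PathSpace N => e (displacement u ω') :=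
    he.comp (measurable_displacement u)
  calc ∫⁻ X, ∫⁻ ω, fkWeight v L ((s : ℝ) + s) X ω * e (worldLine X ω (s + u) - worldLine X ω s)
        ∂wienerPaths N
      = ∫⁻ X, Hh X * φ X := by simp_rw [h1]; exact h2
    _ ≤ ∫⁻ y, (∫⁻ ω', e (displacement u ω') * φ' (y + displacement u ω') ∂wienerPaths N) * φ y :=
        lintegral_mono fun y => mul_le_mul' (h3 y) le_rfl
    _ = ∫⁻ y, ∫⁻ ω', e (displacement u ω') * (φ' (y + displacement u ω') * φ y) ∂wienerPaths N := by
        refine lintegral_congr fun y => ?_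
        have hm : Measurable fun ω' : PathSpace N =>
            e (displacement u ω') * φ' (y + displacement u ω') :=
          hed.mul (hφ'm.comp (measurable_const.add (measurable_displacement u)))
        rw [← lintegral_mul_const _ hm]
        simp only [mul_assoc]
    _ = ∫⁻ ω', ∫⁻ y, e (displacement u ω') * (φ' (y + displacement u ω') * φ y) ∂volume
          ∂wienerPaths N := by
        refine lintegral_lintegral_swap ?_
        exact ((hed.comp measurable_snd).mul ((hφ'm.comp (measurable_fst.add
          ((measurable_displacement u).comp measurable_snd))).mul (hφm.comp measurable_fst))).aemeasurable
    _ = ∫⁻ ω', e (displacement u ω') * ∫⁻ y, φ' (y + displacement u ω') * φ y ∂volume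
          ∂wienerPaths N := by
        refine lintegral_congr fun ω' => ?_
        exact lintegral_const_mul _ ((hφ'm.comp (measurable_id.add_const _)).mul hφm)
    _ ≤ ∫⁻ ω', e (displacement u ω') * ((∫⁻ y, φ' y ^ 2) ^ (1 / 2 : ℝ) * (∫⁻ y, φ y ^ 2) ^ (1 / 2 : ℝ))
          ∂wienerPaths N :=
        lintegral_mono fun ω' => mul_le_mul' le_rfl (lintegral_translate_mul_le hφm hφ'm _)
    _ = (∫⁻ ω, e (displacement u ω) ∂wienerPaths N) *
          ((∫⁻ y, φ' y ^ 2) ^ (1 / 2 : ℝ) * (∫⁻ y, φ y ^ 2) ^ (1 / 2 : ℝ)) := by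
        rw [lintegral_mul_const _ hed]

/-- **The cross-cut Cauchy–Schwarz bound, real times** `0 ≤ τ ≤ T` (the shape of the stub):
`∫dX E_X[w_{2T} e(B_{T+τ} - B_T)] ≤ E[e(√2 b_τ)] · Z(T-τ)^{1/2} · Z(T)^{1/2}`. -/
theorem crossCut_le {v : ℝ → ℝ≥0∞} (hv : Measurable v) (L : ℝ) {T τ : ℝ} (hτ : 0 ≤ τ)
    (hτT : τ ≤ T) {e : Config N → ℝ≥0∞} (he : Measurable e) :
    ∫⁻ X, ∫⁻ ω, fkWeight v L (2 * T) X ω *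
        e (worldLine X ω (T + τ).toNNReal - worldLine X ω T.toNNReal) ∂wienerPaths N ≤
      (∫⁻ ω, e (displacement τ.toNNReal ω) ∂wienerPaths N) *
        (fkNormSq (N := N) v L (T - τ) (fun _ => (1 : ℝ≥0∞)) ^ (1 / 2 : ℝ) *
          fkNormSq (N := N) v L T (fun _ => (1 : ℝ≥0∞)) ^ (1 / 2 : ℝ)) := by
  have hT : 0 ≤ T := hτ.trans hτT
  have hus : τ.toNNReal ≤ T.toNNReal := Real.toNNReal_le_toNNReal hτT
  have h := crossCut_le_nnreal (N := N) hv L hus he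
  have e1 : ((T.toNNReal : ℝ) + T.toNNReal) = 2 * T := by rw [Real.coe_toNNReal _ hT]; ring
  have e2 : T.toNNReal + τ.toNNReal = (T + τ).toNNReal := by
    rw [Real.toNNReal_add hT hτ]
  have e3 : ((T.toNNReal - τ.toNNReal : ℝ≥0) : ℝ) = T - τ := by
    rw [NNReal.coe_sub hus, Real.coe_toNNReal _ hT, Real.coe_toNNReal _ hτ]
  have e4 : ((T.toNNReal : ℝ≥0) : ℝ) = T := Real.coe_toNNReal _ hT
  rw [e1, e2, e3, e4] at h
  exact h

/-- Registered toolbox stub `stub_crossCutBound` (lead a1, from worker W5): the cross-cut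
Cauchy–Schwarz bound for a two-time tagged observable under the `2T`-bridge — general `v`, `N`
(lossy by `(Z(T-τ)/Z(T))^{1/2}` for interacting `v`, sharp enough for the free gas). -/
theorem stub_crossCutBound : ∀ (N : ℕ) (v : ℝ → ℝ≥0∞), Measurable v → ∀ (L T τ : ℝ), 0 ≤ τ → τ ≤ T →
    ∀ (e : Config N → ℝ≥0∞), Measurable e →
      ∫⁻ X, ∫⁻ ω, fkWeight v L (2 * T) X ω *
          e (worldLine X ω (T + τ).toNNReal - worldLine X ω T.toNNReal) ∂wienerPaths N ≤
        (∫⁻ ω, e (displacement τ.toNNReal ω) ∂wienerPaths N) *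
          (fkNormSq (N := N) v L (T - τ) (fun _ => (1 : ℝ≥0∞)) ^ (1 / 2 : ℝ) *
            fkNormSq (N := N) v L T (fun _ => (1 : ℝ≥0∞)) ^ (1 / 2 : ℝ)) :=
  fun _ _ hv L _ _ hτ hτT _ he => crossCut_le hv L hτ hτT he

end TaggedDisplacement

end Summit.AtomisticToContinuum.BoseEinsteinCondensation.Cruxes.TwoReplicaTransienceBound.TaggedShiftLogHarnack

end
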